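import Literature.AlgebraicGeometry.Frobenioids.ModelFrobenioidPreFrobenioid
import Literature.AlgebraicGeometry.Frobenioids.NaiveFrobeniusFunctorLifts
import HarnessLib

/-!
# Frobenioids I, Theorem 5.2 / Proposition 2.1: the naive Frobenius functor of a model Frobenioid is
# "multiplication by `d`" — PROOF

Mochizuki, *The geometry of Frobenioids I*, Kyushu J. Math. **62** (2008). For the model Frobenioid
`C = ModelFrobenioid Φ B Div_B` of Thm. 5.2 (i) (kurims p. 100: objects `(A_D, α)`, morphisms
`(deg_Fr, Base, Div, u)`), the morphism `(d, id, 0, 0) : (A_D, α) → (A_D, d·α)` is of Frobenius type of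
Frobenius degree `d` (p. 101), so the naive Frobenius functor of degree `d` of Prop. 2.1 (i) (p. 44: "`A ↦ A'`,
`φ ↦ φ'` with `φ' ∘ α_A = α_B ∘ φ`") is, on the model, the explicit functor
`(A_D, α) ↦ (A_D, d·α)`, `(deg_Fr, Base, Div, u) ↦ (deg_Fr, Base, d·Div, d·u)`.
This is the computation behind Thm. 6.2 (ii) (p. 110: on the Frobenioid of geometric origin in
characteristic `p`, the functor induced by the Frobenius morphism — pull-back multiplies Cartier divisors
by `p` and raises rational functions to the `p`-th power — "is isomorphic to the naive Frobenius functor of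
degree `p`"). [cite: MochizukiFrdI2008, Prop. 2.1 (i) p.44]

PROVED here (seat abc-iut-L6-t10), over abc-iut-L1-t2's `ModelFrobenioid` / `naiveFrobeniusOf` and
abc-iut-found's `ModelFrobenioid.isCoAngular`: `powFunctor d` (the explicit functor), `powChoice`
(the Frobenius choice `(d, id, 0, 0)`), `powChoice_lift` (the unique lift of Prop. 1.10 (i) IS
`(deg_Fr, Base, d·Div, d·u)`), `powFunctorIso` / `nonempty_powFunctor_iso_naiveFrobeniusOf`.
-/

noncomputable section

namespace Literature.AlgebraicGeometry.Frobenioids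

open CategoryTheory Opposite

universe w v u

namespace ModelFrobenioid

variable {D : Type u} [Category.{v} D] (Φ B : Dᵒᵖ ⥤ CommMonCat.{w}) (DivB : B ⟶ monoidGp Φ) (d : ℕ+)

/-- `(A_D, α) ↦ (A_D, d · α)`. [cite: MochizukiFrdI2008, Prop. 2.1 (i) p.44] -/
def powObj (X : ModelFrobenioid Φ B DivB) : ModelFrobenioid Φ B DivB := ⟨X.base, X.cls ^ (d : ℕ)⟩

/-- The base of `(A_D, d·α)` is `A_D`. [cite: MochizukiFrdI2008, Prop. 2.1 (i) p.44] -/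
@[simp] theorem powObj_base (X : ModelFrobenioid Φ B DivB) : (powObj Φ B DivB d X).base = X.base := rfl

/-- The class of `(A_D, d·α)` is `d·α`. [cite: MochizukiFrdI2008, Prop. 2.1 (i) p.44] -/
@[simp] theorem powObj_cls (X : ModelFrobenioid Φ B DivB) :
    (powObj Φ B DivB d X).cls = X.cls ^ (d : ℕ) := rfl

variable {Φ B DivB}

/-- `(deg_Fr, Base, Div, u) ↦ (deg_Fr, Base, d·Div, d·u) : (A_D, d·α) → (B_D, d·β)` — relation (d) of
Thm. 5.2 (i) is the `d`-th multiple of that of `φ`. [cite: MochizukiFrdI2008, Prop. 2.1 (i) p.44] -/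
def powHom {X Y : ModelFrobenioid Φ B DivB} (φ : X ⟶ Y) : powObj Φ B DivB d X ⟶ powObj Φ B DivB d Y where
  degFr := degFr φ
  base := (baseMap φ :)
  div := (div φ :) ^ (d : ℕ)
  unit := (unit φ :) ^ (d : ℕ)
  rel := by
    show (X.cls ^ (d : ℕ)) ^ (degFr φ : ℕ) * Algebra.GrothendieckGroup.of (div φ ^ (d : ℕ)) =
      pullGp Φ (baseMap φ) (Y.cls ^ (d : ℕ)) * divB Φ B DivB (op X.base) (unit φ ^ (d : ℕ))
    rw [← pow_mul, mul_comm (d : ℕ) _, pow_mul, map_pow, map_pow, map_pow, ← mul_pow, rel φ, mul_pow]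

/-- `deg_Fr` of `powHom φ` is `deg_Fr(φ)`. [cite: MochizukiFrdI2008, Prop. 2.1 (i) p.44] -/
@[simp] theorem degFr_powHom {X Y : ModelFrobenioid Φ B DivB} (φ : X ⟶ Y) :
    degFr (powHom d φ) = degFr φ := rfl

/-- `Base` of `powHom φ` is `Base(φ)`. [cite: MochizukiFrdI2008, Prop. 2.1 (i) p.44] -/
@[simp] theorem baseMap_powHom {X Y : ModelFrobenioid Φ B DivB} (φ : X ⟶ Y) :
    baseMap (powHom d φ) = (baseMap φ :) := rfl

/-- `Div` of `powHom φ` is `d · Div(φ)`. [cite: MochizukiFrdI2008, Prop. 2.1 (i) p.44] -/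
@[simp] theorem div_powHom {X Y : ModelFrobenioid Φ B DivB} (φ : X ⟶ Y) :
    div (powHom d φ) = (div φ :) ^ (d : ℕ) := rfl

/-- `u` of `powHom φ` is `d · u_φ`. [cite: MochizukiFrdI2008, Prop. 2.1 (i) p.44] -/
@[simp] theorem unit_powHom {X Y : ModelFrobenioid Φ B DivB} (φ : X ⟶ Y) :
    unit (powHom d φ) = (unit φ :) ^ (d : ℕ) := rfl

variable (Φ B DivB)

/-- **The explicit Frobenius functor of degree `d` on a model Frobenioid**:
`(A_D, α) ↦ (A_D, d·α)`, `(deg_Fr, Base, Div, u) ↦ (deg_Fr, Base, d·Div, d·u)`.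
[cite: MochizukiFrdI2008, Prop. 2.1 (i) p.44] -/
def powFunctor : ModelFrobenioid Φ B DivB ⥤ ModelFrobenioid Φ B DivB where
  obj := powObj Φ B DivB d
  map φ := powHom d φ
  map_id X := hom_ext rfl rfl (one_pow _) (one_pow _)
  map_comp φ ψ := by
    refine hom_ext rfl rfl ?_ ?_
    · show ((Φ.map (baseMap φ).op).hom (div ψ) * div φ ^ (degFr ψ : ℕ)) ^ (d : ℕ) =
        (Φ.map (baseMap φ).op).hom (div ψ ^ (d : ℕ)) * (div φ ^ (d : ℕ)) ^ (degFr ψ : ℕ)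
      rw [mul_pow, map_pow, ← pow_mul, ← pow_mul, mul_comm (d : ℕ)]
    · show ((B.map (baseMap φ).op).hom (unit ψ) * unit φ ^ (degFr ψ : ℕ)) ^ (d : ℕ) =
        (B.map (baseMap φ).op).hom (unit ψ ^ (d : ℕ)) * (unit φ ^ (d : ℕ)) ^ (degFr ψ : ℕ)
      rw [mul_pow, map_pow, ← pow_mul, ← pow_mul, mul_comm (d : ℕ)]

/-- `powFunctor` on objects. [cite: MochizukiFrdI2008, Prop. 2.1 (i) p.44] -/
@[simp] theorem powFunctor_obj (X : ModelFrobenioid Φ B DivB) :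
    (powFunctor Φ B DivB d).obj X = powObj Φ B DivB d X := rfl

/-- `powFunctor` on morphisms. [cite: MochizukiFrdI2008, Prop. 2.1 (i) p.44] -/
@[simp] theorem powFunctor_map {X Y : ModelFrobenioid Φ B DivB} (φ : X ⟶ Y) :
    (powFunctor Φ B DivB d).map φ = powHom d φ := rfl

/-- The morphism `(d, id, 0, 0) : (A_D, α) → (A_D, d·α)` ("base-identity endomorphisms of Frobenius
type", Thm. 5.2 proof of (ii), p. 101, here between the two objects). [cite: MochizukiFrdI2008, Thm. 5.2 (ii) p.101] -/
def powUnitHom (X : ModelFrobenioid Φ B DivB) : X ⟶ powObj Φ B DivB d X where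
  degFr := d
  base := 𝟙 X.base
  div := 1
  unit := 1
  rel := by
    show X.cls ^ (d : ℕ) * _ = pullGp Φ (𝟙 X.base) (X.cls ^ (d : ℕ)) * _
    rw [map_one, mul_one, map_one, mul_one, pullGp_id]

/-- `(d, id, 0, 0)` followed by `(deg_Fr, Base, d·Div, d·u)` equals `φ` followed by `(d, id, 0, 0)` — the
defining square `φ' ∘ α_A = α_B ∘ φ` of Prop. 2.1 (i). [cite: MochizukiFrdI2008, Prop. 2.1 (i) p.44] -/
theorem powUnitHom_comp_powHom {X Y : ModelFrobenioid Φ B DivB} (φ : X ⟶ Y) :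
    powUnitHom Φ B DivB d X ≫ powHom d φ = φ ≫ powUnitHom Φ B DivB d Y := by
  refine hom_ext (mul_comm _ _) ?_ ?_ ?_
  · show 𝟙 X.base ≫ baseMap φ = baseMap φ ≫ 𝟙 Y.base
    rw [Category.id_comp, Category.comp_id]
  · show (Φ.map (𝟙 X.base).op).hom (div φ ^ (d : ℕ)) * 1 ^ (degFr φ : ℕ) =
      (Φ.map (baseMap φ).op).hom 1 * div φ ^ (d : ℕ)
    rw [op_id, Φ.map_id, CommMonCat.hom_id, MonoidHom.id_apply, one_pow, mul_one, map_one, one_mul]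
  · show (B.map (𝟙 X.base).op).hom (unit φ ^ (d : ℕ)) * 1 ^ (degFr φ : ℕ) =
      (B.map (baseMap φ).op).hom 1 * unit φ ^ (d : ℕ)
    rw [op_id, B.map_id, CommMonCat.hom_id, MonoidHom.id_apply, one_pow, mul_one, map_one, one_mul]

variable {B} (hBg : Objectwise (fun M _ => IsGroupLike M) B)

/-- **`(d, id, 0, 0)` is a morphism of Frobenius type of Frobenius degree `d`** (isometric base-isomorphism,
co-angular by abc-iut-found's `ModelFrobenioid.isCoAngular`): a Frobenius choice of degree `d` in the sense
of Prop. 2.1 (i). [cite: MochizukiFrdI2008, Thm. 5.2 (ii) p.101] -/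
def powChoice : PreFrobenioid.FrobeniusChoice (toElem Φ B DivB) d where
  obj := powObj Φ B DivB d
  hom := powUnitHom Φ B DivB d
  isFrobeniusType X := ⟨⟨isCoAngular hBg _, rfl⟩, show IsIso (𝟙 X.base) from inferInstance⟩
  degFr_eq _ := rfl

include hBg in
/-- The unique lift `φ'` of Prop. 1.10 (i) along the Frobenius choice `(d, id, 0, 0)` IS
`(deg_Fr, Base, d·Div, d·u)`. [cite: MochizukiFrdI2008, Prop. 2.1 (i) p.44] -/
theorem powChoice_lift (h : PreFrobenioid.HasFrobeniusLifts (toElem Φ B DivB) d)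
    {X Y : ModelFrobenioid Φ B DivB} (φ : X ⟶ Y) :
    (powChoice Φ DivB d hBg).lift h φ = powHom d φ :=
  ((powChoice Φ DivB d hBg).lift_unique h φ (powHom d φ) (powUnitHom_comp_powHom Φ B DivB d φ)).symm

/-- The explicit functor is (isomorphic to, indeed equal on the nose to) the naive Frobenius functor of the
Frobenius choice `(d, id, 0, 0)`. [cite: MochizukiFrdI2008, Prop. 2.1 (i) p.44] -/
def powFunctorIso (h : PreFrobenioid.HasFrobeniusLifts (toElem Φ B DivB) d) :
    powFunctor Φ B DivB d ≅ PreFrobenioid.naiveFrobenius (powChoice Φ DivB d hBg) h :=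
  NatIso.ofComponents (fun _ => Iso.refl _) fun {X Y} φ => by
    change powHom d φ ≫ 𝟙 (powObj Φ B DivB d Y) = 𝟙 (powObj Φ B DivB d X) ≫ (powChoice Φ DivB d hBg).lift h φ
    rw [Category.comp_id, Category.id_comp, powChoice_lift]

include hBg in
/-- **The naive Frobenius functor of degree `d` of a model Frobenioid (which is a Frobenioid, Thm. 5.2 (ii))
is isomorphic to `(A_D, α) ↦ (A_D, d·α)`, `(deg_Fr, Base, Div, u) ↦ (deg_Fr, Base, d·Div, d·u)`**
(Prop. 2.1 (i), "well-defined up to isomorphism"). [cite: MochizukiFrdI2008, Prop. 2.1 (i) p.44] -/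
theorem nonempty_powFunctor_iso_naiveFrobeniusOf (hF : PreFrobenioid.IsFrobenioid (toElem Φ B DivB)) :
    Nonempty (powFunctor Φ B DivB d ≅ PreFrobenioid.naiveFrobeniusOf hF d) :=
  ⟨powFunctorIso Φ DivB d hBg (PreFrobenioid.hasFrobeniusLifts hF d) ≪≫
    PreFrobenioid.naiveFrobeniusIsoOf hF (powChoice Φ DivB d hBg) _⟩

end ModelFrobenioid

end Literature.AlgebraicGeometry.Frobenioids

end
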